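import Summits.QuantumFields.BalabanUV.T4Continuum.Support.NE7HessianFloorModGauge
import Summits.QuantumFields.BalabanUV.T4Continuum.Support.NE3ClassRadiusFamily
import Summits.QuantumFields.BalabanUV.T4Continuum.Support.NE7RoutePiRegimeSU2
import HarnessLib

/-!
# NE7HessianFloorModGaugeSU2 — THE HESSIAN HALF OF THE SLICED CURVED LOWER BOUND WITH NO DISPLAYED HYPOTHESIS BUT `0 < ε ≤ 10⁻⁵³`: d = 4, L = 2, SU(2), every level `j`, every volume `N`
# (this gen's G4 ✓ `NE7HessianFloorModGauge.exists_cornerGauge_hess_floor` with row NE3-R2's class slice Poincaré ✓ `NE3ClassSlicePoincare.classSlicePoincare_SU2` — constant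
# `C_P = CPLine 4 2 2 10⁻¹⁷ 10⁻⁵³ ≤ 1234·10¹⁴` — and every k-free ε-line DISCHARGED in numbers; lineage `b2b-balaban-t4-ne7-p1`, gen 118, file G8; ROAD-G118 §5 (S2))

Cell `pub-balaban`, rung (B)+1 sub-cell t4, CRUX PROVER NE7 #1 (OWNER of row NE7), generation 118.  The numeric lines (all `norm_num` over the tree's named constants): `radD 4 2 = 370278400`,
`twoLevelSmall 4 2 = 26843545600`, `mC 4 2 2 ≤ 2·10¹⁵` (`√massErrC 4 2 ≤ 1.2·10⁷`, `massRemC 4 2 = 27568`, `√2 ≤ 3∕2`), `thetaLoc 4 2 < 10¹⁹` (✓ `NE7RoutePiRegimeSU2.thetaLoc_4_2_lt`),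
`cruxC ≤ thetaLoc`, `#planes = 6`, the absorption line `28·6·ε·(4·C_P·2) ≤ 1`; the class radius dictionary `ε∕(2^{k})² = ε·(2²)⁻¹^k` and row NE3-R2's level family from ✓ `levelSmall_of_class_radius`.
WHAT ([folklore]; 0 def, 0 sorry): `mC_4_2_2_le`, `classRadius_eq_div`, **`exists_cornerGauge_hess_floor_SU2`**: for `card n = 2`, `N ≥ 1`, `0 < ε ≤ 10⁻⁵³`, every `j`, every unitary
`(tower 2 N (j+1))`-periodic `U` with `SmallField U (ε·4^{−(j+1)})` (= `U ∈ sfClass 4 2 N ε (j+1)`), every `θ > 0` and every skew fine torus field `X`: a corner-trivial `μ` with `levelQ′(X + ξ_μ) = levelQ′ X`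
and **`Σ_P nhs(curl_{V₀}ṽ(P)) ≤ ((1+θ) + 2K·(8·C_P))·hess U X̃′ X̃′ + 2K·(2·liftMassC 4 2 + 4C_P·liftCurlC 4 2)·Σ_b‖ṽ_b‖²`**, `K = (1+θ)·84ε + (1+θ⁻¹)·36·eC(4,2,2)²·ε²`, `C_P = CPLine 4 2 2 10⁻¹⁷ 10⁻⁵³`.
HONEST FRAMING (page 1): a numeric instantiation of landed kernel theorems about OUR objects; the multiplier term of the bordered Hessian is NOT bounded here; nothing of Bałaban's asserted;
NOT (G′), NOT NE7 as a spine node, NOT NE3; spine 0∕9; finite T⁴ rung (B)+1 — NOT infinite volume, NOT mass gap, NOT BetaPertH, NOT Clay.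
-/

set_option autoImplicit false

open scoped BigOperators Matrix Matrix.Norms.L2Operator
open NormedSpace Finset

namespace Summit.QuantumFields.BalabanUV.T4Continuum.NE7HessianFloorModGaugeSU2

open Literature.MathematicalPhysics.QuantumFieldTheory.Balaban1983to89
open B7Prop1Explicit B7Prop2Explicit MatrixLog UnitaryModel
open T4AveragingDeficitWall (IsUnitaryCfg IsSkewDir SmallField Ad curl curlAt curlSq dirSq)
open T4AveragingDeficitWallBoundary (IsPeriodicCfg periodBox)
open AveragingDeficitTorusChart (TDir chartDir resDir)
open AveragingDeficitTwoLevelPrep (twoLevelSmall skewSub skewPR)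
open AveragingDeficitMultiLevelPrep (cavgIter tower levelQ' LevelSmall)
open MatrixNorms (nhsNormSq)
open MinimalActionLevels (perWin)
open NE3HessForm (hess)
open NE7RadIterUniform (radD levelSmall_of_class_radius)
open NE7StraightTowerCurlEnergy (eC mC)
open NE7QbarMassLetter (massErrC massRemC)
open BlockAveragePushDirGauge (gaugeDir)
open NE3QbarIterCovLiftPrep (cruxC)
open NE3RightInverseSolveLetters (thetaLoc cruxC_le_thetaLoc cruxC_nonneg)
open NE3SlicePoincareShape (SlicePoincare)
open NE3FrameFreeSliceW (frameFreeBlockLandauW)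
open NE3EnergyRateWSupOfSlicePoincare (tower_eq_mul_pow)
open NE3SlicePoincareBudgetLine (CPLine)
open NE3ClassSlicePoincare (classSlicePoincare_SU2 lines_d4_L2_c2)
open NE3ClassRadiusFamily (CPLine_nonneg_d4_L2)
open NE7RoutePiRegimeSU2 (thetaLoc_4_2_lt thetaLoc_mul_lt_one)
open NE7SliceRepHessianFloor (liftMassC liftCurlC)
open NE7HessianFloorModGauge (exists_cornerGauge_hess_floor)

noncomputable section

variable {n : Type*} [Fintype n] [DecidableEq n]

/-! ## §1 The numeric lines at `d = 4`, `L = 2`, SU(2) -/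

omit [Fintype n] [DecidableEq n] in
/-- `mC 4 2 2 ≤ 2·10¹⁵` (`√massErrC 4 2 ≤ 1.2·10⁷`, `massRemC 4 2 = 27568`, `√2 ≤ 3∕2`). [folklore] -/
theorem mC_4_2_2_le : mC 4 2 2 ≤ 2 * 10 ^ 15 := by
  have h1 : Real.sqrt (massErrC 4 2) ≤ 12000000 := by
    rw [Real.sqrt_le_left (by norm_num)]
    unfold massErrC; norm_num
  have h2 : massRemC 4 2 = 27568 := by unfold massRemC; norm_num
  have h3 : Real.sqrt 2 ≤ 3 / 2 := by
    rw [Real.sqrt_le_left (by norm_num)]; norm_num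
  have h0 : 0 ≤ Real.sqrt (massErrC 4 2) := Real.sqrt_nonneg _
  have h0' : 0 ≤ Real.sqrt 2 := Real.sqrt_nonneg _
  unfold mC
  rw [h2]
  have h4 : (16 * (((4 : ℕ) : ℝ) + 1) * (((4 : ℕ) : ℝ) + 4) * (((2 : ℕ) : ℝ)) ^ 2) = 2560 := by norm_num
  rw [h4]
  calc Real.sqrt (massErrC 4 2) * 27568 * 2560 * Real.sqrt ((2 : ℕ) : ℝ)
      ≤ 12000000 * 27568 * 2560 * (3 / 2) := by
        have e : ((2 : ℕ) : ℝ) = 2 := by norm_num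
        rw [e]
        have := mul_le_mul (mul_le_mul_of_nonneg_right (mul_le_mul_of_nonneg_right h1 (by norm_num : (0:ℝ) ≤ 27568)) (by norm_num : (0:ℝ) ≤ 2560)) h3 h0' (by positivity)
        exact this
    _ ≤ 2 * 10 ^ 15 := by norm_num

omit [Fintype n] [DecidableEq n] in
/-- The class radius dictionary: `ε ∕ (2^k)² = ε·(2²)⁻¹^k`. [folklore] -/
theorem classRadius_eq_div (ε : ℝ) (k : ℕ) : ε / (((2 : ℕ) : ℝ) ^ k) ^ 2 = ε * ((((2 : ℕ) : ℝ) ^ 2)⁻¹) ^ k := by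
  rw [div_eq_mul_inv, pow_right_comm, inv_pow]

/-! ## §2 The Hessian floor modulo corner-trivial gauge directions, SU(2), `L = 2`, in numbers -/

/-- **THE HESSIAN HALF OF THE SLICED CURVED LOWER BOUND, d = 4, L = 2, SU(2), NO DISPLAYED HYPOTHESIS BUT `0 < ε ≤ 10⁻⁵³`** (see the module docstring). [cite: Balaban1985Averaging, (48) p.25;
Balaban1985PropagatorsII, Thm 3.3 (3.46); Balaban1985Variational, (83) p.290] -/
theorem exists_cornerGauge_hess_floor_SU2 [Nonempty n] (hn : Fintype.card n = 2) {N : ℕ} [NeZero N] (hN : 1 ≤ N) {ε : ℝ} (hε : 0 < ε) (hε' : ε ≤ 1 / 10 ^ 53) (j : ℕ)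
    {U : Site 4 → Fin 4 → (Matrix n n ℂ)ˣ} (hU : IsUnitaryCfg U) (hUP : IsPeriodicCfg U ((tower 2 N (j + 1) : ℕ) : ℤ))
    (hUx : SmallField U (ε * ((((2 : ℕ) : ℝ) ^ 2)⁻¹) ^ (j + 1))) {θ : ℝ} (hθ : 0 < θ) (X : ↥(skewSub 4 n (2 * tower 2 N j))) :
    ∃ mu : Site 4 → Matrix n n ℂ, (∀ y, mu y ∈ skewAdjoint (Matrix n n ℂ))
      ∧ (∀ (y : Site 4) (i : Fin 4), mu (y + ((2 * tower 2 N j : ℕ) : ℤ) • e i) = mu y)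
      ∧ (∀ w : Site 4, mu (((2 : ℤ) ^ (j + 1)) • w) = 0)
      ∧ levelQ' 2 N j U ((X + skewPR (d := 4) (n := n) (2 * tower 2 N j) (resDir (2 * tower 2 N j) (gaugeDir U mu)) : ↥(skewSub 4 n (2 * tower 2 N j)))
            : TDir 4 n (2 * tower 2 N j)) = levelQ' 2 N j U (X : TDir 4 n (2 * tower 2 N j))
      ∧ ∑ P ∈ perWin 4 N, nhsNormSq
          (curl (cavgIter 2 (j + 1) U) (chartDir (ContinuousLinearMap.id ℝ (Matrix n n ℂ)) N ((levelQ' 2 N j U (X : TDir 4 n (2 * tower 2 N j)) : ↥(skewSub 4 n N)) : TDir 4 n N)) P)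
        ≤ ((1 + θ) + 2 * ((1 + θ) * (14 * (Fintype.card (T4AveragingDeficitWall.Plane 4) : ℝ) * ε) + (1 + θ⁻¹) * (36 * eC 4 2 (Fintype.card n) ^ 2 * ε ^ 2))
              * (4 * CPLine 4 2 2 (1 / 10 ^ 17) (1 / 10 ^ 53) * Fintype.card n))
            * hess U (chartDir (ContinuousLinearMap.id ℝ (Matrix n n ℂ)) (2 * tower 2 N j)
                  ((X + skewPR (d := 4) (n := n) (2 * tower 2 N j) (resDir (2 * tower 2 N j) (gaugeDir U mu)) : ↥(skewSub 4 n (2 * tower 2 N j))) : TDir 4 n (2 * tower 2 N j)))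
                (chartDir (ContinuousLinearMap.id ℝ (Matrix n n ℂ)) (2 * tower 2 N j)
                  ((X + skewPR (d := 4) (n := n) (2 * tower 2 N j) (resDir (2 * tower 2 N j) (gaugeDir U mu)) : ↥(skewSub 4 n (2 * tower 2 N j))) : TDir 4 n (2 * tower 2 N j)))
                (perWin 4 (tower 2 N (j + 1)))
          + 2 * ((1 + θ) * (14 * (Fintype.card (T4AveragingDeficitWall.Plane 4) : ℝ) * ε) + (1 + θ⁻¹) * (36 * eC 4 2 (Fintype.card n) ^ 2 * ε ^ 2))
              * ((2 * liftMassC 4 2 + 4 * CPLine 4 2 2 (1 / 10 ^ 17) (1 / 10 ^ 53) * liftCurlC 4 2)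
                  * dirSq (chartDir (ContinuousLinearMap.id ℝ (Matrix n n ℂ)) N ((levelQ' 2 N j U (X : TDir 4 n (2 * tower 2 N j)) : ↥(skewSub 4 n N)) : TDir 4 n N))
                      (periodBox N)) := by
  have hε0 : 0 ≤ ε := hε.le
  have hε1 : ε ≤ 1 := hε'.trans (by norm_num)
  -- the k-free ε-lines in numbers
  have hεD : 4 * ε * radD 4 2 * (((((2 : ℕ) : ℝ)) ^ 2)⁻¹) ^ 2 ≤ 1 := by
    have e : radD 4 2 = 370278400 := by unfold radD; norm_num
    rw [e]; norm_num; linarith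
  have hεT : twoLevelSmall 4 2 * (2 * ε * ((((2 : ℕ) : ℝ)) ^ 2)⁻¹) ≤ 1 := by
    unfold twoLevelSmall; norm_num; linarith
  have hεM : 8 * (((2 : ℕ) : ℝ)) * mC 4 2 (Fintype.card n) * ε * ((((2 : ℕ) : ℝ)) ^ 2)⁻¹ ≤ 1 := by
    rw [hn]
    have hm := mC_4_2_2_le
    have hm0 : 0 ≤ mC 4 2 2 := NE7StraightTowerCurlEnergy.mC_nonneg 4 2
    have e : 8 * (((2 : ℕ) : ℝ)) * mC 4 2 ((2 : ℕ) : ℝ) * ε * ((((2 : ℕ) : ℝ)) ^ 2)⁻¹ = 4 * (mC 4 2 2 * ε) := by push_cast; ring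
    rw [e]
    have : mC 4 2 2 * ε ≤ 2 * 10 ^ 15 * (1 / 10 ^ 53) := mul_le_mul hm hε' hε0 (by norm_num)
    linarith
  have hθL := thetaLoc_4_2_lt
  have hθ0 : 0 ≤ thetaLoc 4 2 := (cruxC_nonneg 4 2).trans (cruxC_le_thetaLoc 4 2)
  have hθl2 : thetaLoc 4 2 * ε ≤ 1 / 2 := by
    have : thetaLoc 4 2 * ε ≤ 10 ^ 19 * (1 / 10 ^ 53) := mul_le_mul hθL.le hε' hε0 (by norm_num)
    linarith
  have hcrux : cruxC 4 2 * ε < 1 := lt_of_le_of_lt (mul_le_mul_of_nonneg_right (cruxC_le_thetaLoc 4 2) hε0) (thetaLoc_mul_lt_one hε hε')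
  have hEl : 43584 * ε ≤ 1 / 2 := by linarith
  -- row NE3-R2's class slice Poincaré, SU(2), L = 2
  have hsmall : ∀ k : ℕ, LevelSmall 4 2 (k + 1) (ε / ((((2 : ℕ) : ℝ)) ^ (k + 2)) ^ 2) := by
    intro k
    rw [classRadius_eq_div]
    exact (levelSmall_of_class_radius (d := 4) (L := 2) (by norm_num) hε0 hεD hεT (k + 1)).1
  have hmem : U ∈ MinimalActionRate.sfClass (d := 4) 2 N ε (j + 1) := by
    refine ⟨hU, ?_, ?_⟩
    · rw [← tower_eq_mul_pow]; exact hUP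
    · rw [classRadius_eq_div]; exact hUx
  have hSP := classSlicePoincare_SU2 hn hN hε hε' hsmall j U hmem
  have hCP := CPLine_nonneg_d4_L2
  obtain ⟨-, -, -, -, hCPle⟩ := lines_d4_L2_c2
  have habs : 28 * (Fintype.card (T4AveragingDeficitWall.Plane 4) : ℝ) * ε * (4 * CPLine 4 2 2 (1 / 10 ^ 17) (1 / 10 ^ 53) * Fintype.card n) ≤ 1 := by
    rw [hn, show Fintype.card (T4AveragingDeficitWall.Plane 4) = 6 from by rfl]
    have : ε * CPLine 4 2 2 (1 / 10 ^ 17) (1 / 10 ^ 53) ≤ (1 / 10 ^ 53) * (1234 * 10 ^ 14) := mul_le_mul hε' hCPle hCP (by norm_num)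
    push_cast
    nlinarith
  exact exists_cornerGauge_hess_floor (L := 2) (by norm_num) hN hε0 hεD hεT hεM hε1 hcrux hθl2 hEl j hU hUP hUx hCP hSP habs hθ X

end

end Summit.QuantumFields.BalabanUV.T4Continuum.NE7HessianFloorModGaugeSU2
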